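import Literature.MathematicalPhysics.QuantumFieldTheory.Balaban1983to89.B9Eq325ProjFormula
import Literature.MathematicalPhysics.QuantumFieldTheory.Balaban1983to89.B9Eq319BlockTentLift

/-!
# `Balaban1983to89.B9Eq365QGGQLowerVariational` — T. Bałaban, *Propagators for lattice gauge theories in a background field*, Commun. Math.
# Phys. **99** (1985) 389–434 [Balaban1985BackgroundPropagators] Thm 3.11 p. 416 with (3.25) p. 394 and (3.65)–(3.67) p. 403: **THE THIRD OPERATOR
# `Q′G′²Q′*` OF THM 3.11 IS BOUNDED BELOW AT THE FLAT BACKGROUND BY AN EXPLICIT, VOLUME-FREE CONSTANT — `κ·‖ψ‖² ≤ ⟪ψ, Q̃′G′(1)²Q̃′†ψ⟫ = ‖G′(1)Q̃′†ψ‖²`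
# with `κ = κ(d, L, η, c₀L^d∕c₁, a′)`, η-FREE ON THE DIAGONAL `ηL = 1` (there `κ ≥ (16d(729∕16)^d + a′)⁻²`)** — by a FIRST-ORDER variational principle
# with a Lipschitz TENT test vector on the blocks; sub-step S3c («the knot») of route R2′ STEP B7′ of the pub-balaban NE9 chain, flat case

statement-level skeleton of published theorems with citation tags; proofs where landed; nothing here is a claim about the Yang–Mills mass gap

CITATION HEADER (lean-in-tree rule).  Audit cell `pub-balaban`, sub-cell `t4`, BINDER row NE9; filed by NE9 formalisation-swarm LEAF PROVER 01
(`b2b-balaban-t4-ne9-formalise-leaf-01`, gen 78) as sub-step **S3c** of route R2′ STEP B7′ (`t4/ROUTES-NE9.md` v13.19.1 l.408, crux ideation lens 1;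
hand-off by name [NE9IDEA1-G82-INBOX]; first refusal TRANSFERRED to this seat by ne9-leaf-06 g63, journal W-ne9leaf06-g63-2 l.45066, whose S3d
`B9Eq325RLipschitzResolvent` DISPLAYS the constant `κ` proved here, in exactly this currency).  Source READ in the held text layer
(`paper:balaban1985-cmp99-background-propagators`, journal page = PDF page + 388): p. 393 (3.15)∕(3.19), p. 394 (3.20)–(3.25), p. 416 Thm 3.11.

THE PRINT (verbatim).  p. 416: *«Theorem 3.11. Under the assumptions of the Theorems 3.1–3.10 (i.e. for M sufficiently large and α₀ sufficiently small)
the operators Δ′_a, G′, (Q′G′²Q′*)⁻¹, Δ_a, G are positive definite. This is obvious for the first three operators …»*; p. 394 (3.25): *«Rf = (I −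
G′Q′*(Q′G′²Q′*)⁻¹Q′G′)f, where G′ = G′(U) = (Δ′_a)⁻¹»*; p. 403: *«the operators R(U), P(U) = I − R(U) … satisfy the same bounds»* — every perturbative
statement about `R(U)` goes through a LOWER bound of `Q′G′²Q′*` whose size print never displays.  The tree's lit-balaban b06 cell certified the
variational DEVICE for the abelian block-spin analogue ([Balaban1984PropagatorsII] p. 236: *«Next we consider the quadratic form ⟨ω, Q′G′Q′*ω⟩. Of
course it is positive definite and to bound it from below we use …»* (2.74)–(2.77), `γ₀` «a positive, absolute constant» — print's route is a Fourier
representation; b06's `QGQInverse.two_dot_sub_form_le_inv_form` is the variational one, real matrices, per-level `L`); THIS file re-runs the ARGUMENT at the chain's one-step letters over `ℂ`, with an `L_chain`-free bump, as the route text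
asks («the ARGUMENT is re-run at the one-step letters … not the files instantiated»).

WHY (route R2′ STEP B7′, (d3)-η).  ne9-leaf-06's S3a `B9Eq325ProjFormula` CONSTRUCTS `(Q′G′²Q′†)⁻¹` from the positivity `‖G′Q′†ψ‖² > 0`
(`qggq_pos`); S3d (`B9Eq325RLipschitzResolvent`) assembles `‖R_U − R_1‖ ≤ C_R♯·α` from five displayed letters, among them the COERCIVITY `κ` of
`K′ = Q̃′G′²Q̃′†` — «deliberately NOT derived from `‖Δ′_a‖` which carries `η⁻²`».  This file PRODUCES `κ` at the flat background with NO operator norm of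
`Δ′_a` and NO volume: the route's claim that the (d3)-η obstruction does not sit in the third operator, in kernel form for `U = 1`.

WHAT IS PROVED (sorry-free; 0 `def`; axioms standard; [folklore] finite-dimensional Hilbert-space algebra + elementary lattice bookkeeping; nothing
of [B9] asserted as printed).
* §1 ABSTRACT (`RCLike 𝕜`, `T` symmetric positive definite, `G := greenK T`): **`two_re_inner_sub_form_le_re_inner_green`** — the FIRST-ORDER variational
  principle `2re⟪u, x⟫ − re⟪u, Tu⟫ ≤ re⟪x, Gx⟫` for EVERY test vector `u` (expand `0 ≤ re⟪Gx − u, T(Gx − u)⟫`); **`sq_div_mul_le_re_inner_green`** — its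
  optimised form `(β²∕M)·P ≤ re⟪x, Gx⟫` from `βP ≤ re⟪u, x⟫`, `re⟪u, Tu⟫ ≤ MP`; `inner_qggq_eq_norm_sq` (`⟪ψ, QG²Q†ψ⟫ = ‖GQ†ψ‖²`);
  **`sq_mul_norm_sq_le_re_inner_qggq`** — Cauchy–Schwarz transfer: `κ₁‖ψ‖² ≤ re⟪Q†ψ, GQ†ψ⟫` and `‖Q‖ ≤ N` give `(κ₁∕N)²‖ψ‖² ≤ re⟪ψ, QG²Q†ψ⟫`.
  (Only the FORM `re⟪u, Tu⟫` of the test vector is needed — never `‖Tu‖`: this is why a merely Lipschitz bump suffices below.)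
* (THE TEST-VECTOR KIT — the tent profile, the block geometry of a forward step, block-modulated lifts at the flat background, the tent's step
  bound and block sum — is the companion file `B9Eq319BlockTentLift` of this generation, consumed BY NAME in §2.)
* §2 **`qggq_coercive_flat`** — for `3 ≤ L`, `0 < a′` and the displayed positivity `hpos′` of `Δ′_{a′}(1)` (`B9Eq3119DeltaPiCarrier.laplacePrimeA` at
  `U = 1`; a theorem by `B9Thm311DeltaPrimeA.laplacePrimeA_pos`), EVERY `ψ : SiteL2K ℂ d m c₁ W` satisfies
  `κ‖ψ‖² ≤ re⟪ψ, (Q̃′ ∘ G′ ∘ G′ ∘ Q̃′†)ψ⟫`, `Q̃′ := (WL2.linearEquiv ℂ ℂ (fun _ => c₁)).symm ∘ₗ QprimeW L m φ 1`, `G′ := GpOfU L m φ η 1 a′ hpos′` — EXACTLY the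
  operator of `B9Eq325ProjFormula.QGGQ_pos` — with `κ = (β²∕(E + a′β²))²·(c₀L^d∕c₁)`, `β = ((L−1)(L−2)∕6)^d`, `E = |η⁻¹|²(L(L²∕4)^{d−1})²·d·(c₀L^d∕c₁)`;
  **`qggq_coercive_one`** — the same with `hpos′` DISCHARGED by `B9Thm311DeltaPrimeA.laplacePrimeA_one_pos` (the operator of ne9-leaf-06's
  `QGGQ_pos_one` verbatim; letters left: `3 ≤ L`, `η ≠ 0`, `0 < a′`); **`qggq_constant_diagonal_ge`** — on the diagonal `ηL = 1` with canonical weights `c₀L^d = c₁`: `κ ≥ (16d(729∕16)^d + a′)⁻²`, a function of `(d, a′)` ONLY.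
MODEL ∕ HONEST SCOPE.  Flat background only (the windowed `U` — S3c's second half, (3.65)–(3.67) — is NOT here); crude constants (no attempt at the optimal
bump); `κ` depends on `η` and `L` only through `ηL` and on the weights only through `c₀L^d∕c₁`, and NOT on `m` (the volume) nor on any operator norm —
this is the file's point, not a claim about print's constants; `3 ≤ L` (a tent needs an interior site).  NOT NE9, NOT the route (cell pub-balaban: NE9 NOT
PRINTED ∕ NOT PROVED; «NE9 ⇐ the named binders»; row WALLED ON A MODEL (O-NE9-1; #5 UNRULED); spine PROVED 0∕9; rung (B)+1 on a finite T⁴ — NOT infinite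
volume, NOT mass gap, NOT Clay; HONEST DEPENDENCY: continuum YM on T⁴ ⇐ BetaPertH ∧ nine spine estimates (0/9 proved); BetaPertH ⇐ (D1) ∧ (D4) ∧ CAP+tail;
G-an2-4 gates asym, D1 and NE2/3/4).  NEW file importing `B9Eq325ProjFormula` (ne9-leaf-06 g63: `laplacePrimeA_isSymmetric`) and this generation's kit
`B9Eq319BlockTentLift`; nothing modified.  Net new unproved facts: 0.
-/

noncomputable section

open scoped InnerProductSpace ComplexConjugate BigOperators

namespace Literature.MathematicalPhysics.QuantumFieldTheory.Balaban1983to89.B9Eq365QGGQLowerVariational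

open B4Sect5Torus (TSite)
open B9SectCLatticeCarrier (Bond)
open B9Eq311L2Pairing (WL2)
open B9Eq319QprimeTorus (fineP offset blockCoord)
open B11Eq103H1Complex (SiteL2K greenK apply_greenK covDerivL2K)
open B9Eq310HessianOperator (adTransportW)
open B5Eq172HodgePositivity (hRS_one)
open B9Eq326OperatorAssembly (QprimeW)
open B9Eq3119DeltaPiCarrier (laplacePrimeA GpOfU)
open B9Eq325ProjFormula (laplacePrimeA_isSymmetric)
open B9Thm311DeltaPrimeA (laplacePrimeA_one_pos)
open B9Eq319BlockTentLift (sum_profile_eq QprimeWL2_one_lift norm_sq_covDerivL2K_lift_le re_inner_laplacePrimeA_one norm_sq_QprimeWL2_one_le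
  sum_blockOf_tent norm_tent_step_le)

/-! ## §1 The first-order variational principle for `T⁻¹` (abstract, `RCLike`) -/

section Abstract

variable {𝕜 : Type*} [RCLike 𝕜] {E : Type*} [NormedAddCommGroup E] [InnerProductSpace 𝕜 E] [FiniteDimensional 𝕜 E]
  {F : Type*} [NormedAddCommGroup F] [InnerProductSpace 𝕜 F] [FiniteDimensional 𝕜 F]
  {T : E →ₗ[𝕜] E} (hTs : T.IsSymmetric) (hpos : ∀ x : E, x ≠ 0 → 0 < RCLike.re ⟪x, T x⟫_𝕜)

include hTs in
/-- **THE FIRST-ORDER VARIATIONAL PRINCIPLE** for the inverse `G = T⁻¹` of a symmetric positive definite `T`: for EVERY test vector `u`,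
`2·re⟪u, x⟫ − re⟪u, Tu⟫ ≤ re⟪x, Gx⟫` (expand `0 ≤ re⟪Gx − u, T(Gx − u)⟫`) — the device by which [B6]'s lower bound (2.77) of `Q′G′Q′*` is obtained
from ONE test field (print: Fourier representation; the cell's b06 `QGQInverse.two_dot_sub_form_le_inv_form` for real matrices). [folklore]
[cite: Balaban1984PropagatorsII, (2.74)–(2.77) p.236] -/
theorem two_re_inner_sub_form_le_re_inner_green (x u : E) :
    2 * RCLike.re ⟪u, x⟫_𝕜 - RCLike.re ⟪u, T u⟫_𝕜 ≤ RCLike.re ⟪x, greenK T hpos x⟫_𝕜 := by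
  set g := greenK T hpos x with hg
  have hTg : T g = x := apply_greenK hpos x
  have h0 : 0 ≤ RCLike.re ⟪g - u, T (g - u)⟫_𝕜 := by
    by_cases h : g - u = 0
    · rw [h, inner_zero_left, map_zero]
    · exact (hpos _ h).le
  have h1 : ⟪g, T u⟫_𝕜 = ⟪x, u⟫_𝕜 := by rw [← hTs g u, hTg]
  have h2 : ⟪u, T g⟫_𝕜 = ⟪u, x⟫_𝕜 := by rw [hTg]
  have h3 : ⟪g, T g⟫_𝕜 = ⟪g, x⟫_𝕜 := by rw [hTg]
  have e : RCLike.re ⟪g - u, T (g - u)⟫_𝕜 = RCLike.re ⟪x, g⟫_𝕜 - 2 * RCLike.re ⟪u, x⟫_𝕜 + RCLike.re ⟪u, T u⟫_𝕜 := by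
    rw [map_sub, inner_sub_left, inner_sub_right, inner_sub_right, h1, h2, h3, map_sub, map_sub, map_sub,
      inner_re_symm (𝕜 := 𝕜) g x, inner_re_symm (𝕜 := 𝕜) x u]
    ring
  linarith

include hTs in
/-- **OPTIMISED**: if a test vector `u` has `β·P ≤ re⟪u, x⟫` and `re⟪u, Tu⟫ ≤ M·P` (`M > 0`, `β, P ≥ 0`), then `(β²∕M)·P ≤ re⟪x, Gx⟫`
(the previous inequality at the real multiple `(β∕M)·u`). [folklore] [cite: Balaban1984PropagatorsII, (2.74)–(2.77) p.236] -/
theorem sq_div_mul_le_re_inner_green {x u : E} {β M P : ℝ} (hM : 0 < M) (hβ : 0 ≤ β)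
    (hux : β * P ≤ RCLike.re ⟪u, x⟫_𝕜) (huu : RCLike.re ⟪u, T u⟫_𝕜 ≤ M * P) :
    β ^ 2 / M * P ≤ RCLike.re ⟪x, greenK T hpos x⟫_𝕜 := by
  set s : ℝ := β / M with hs
  have hs0 : 0 ≤ s := div_nonneg hβ hM.le
  have h := two_re_inner_sub_form_le_re_inner_green hTs hpos x (((s : ℝ) : 𝕜) • u)
  have e1 : RCLike.re ⟪((s : ℝ) : 𝕜) • u, x⟫_𝕜 = s * RCLike.re ⟪u, x⟫_𝕜 := by
    rw [inner_smul_left, RCLike.conj_ofReal, RCLike.re_ofReal_mul]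
  have e2 : RCLike.re ⟪((s : ℝ) : 𝕜) • u, T (((s : ℝ) : 𝕜) • u)⟫_𝕜 = s * s * RCLike.re ⟪u, T u⟫_𝕜 := by
    rw [map_smul, inner_smul_left, inner_smul_right, RCLike.conj_ofReal, ← mul_assoc, ← RCLike.ofReal_mul, RCLike.re_ofReal_mul]
  rw [e1, e2] at h
  have h3 : s * (β * P) ≤ s * RCLike.re ⟪u, x⟫_𝕜 := mul_le_mul_of_nonneg_left hux hs0
  have h4 : s * s * RCLike.re ⟪u, T u⟫_𝕜 ≤ s * s * (M * P) := mul_le_mul_of_nonneg_left huu (mul_nonneg hs0 hs0)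
  have h5 : β ^ 2 / M * P = 2 * (s * (β * P)) - s * s * (M * P) := by
    rw [hs]; field_simp; ring
  linarith

include hTs in
/-- **`⟪ψ, QG²Q†ψ⟫ = ‖GQ†ψ‖²`** for `G = T⁻¹`, `T` symmetric (so `⟪y, GGy⟫ = ⟪TGy, GGy⟫ = ⟪Gy, TGGy⟫ = ⟪Gy, Gy⟫`; abstract twin of ne9-leaf-06's
`B9Eq325ProjFormula.inner_qggq_eq`). [folklore] [cite: Balaban1985BackgroundPropagators, (3.25) p.394, Thm 3.11 p.416] -/
theorem inner_qggq_eq_norm_sq (Q : E →ₗ[𝕜] F) (ψ : F) :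
    ⟪ψ, Q (greenK T hpos (greenK T hpos (LinearMap.adjoint Q ψ)))⟫_𝕜 = ((‖greenK T hpos (LinearMap.adjoint Q ψ)‖ : ℝ) : 𝕜) ^ 2 := by
  rw [← LinearMap.adjoint_inner_left]
  set y := LinearMap.adjoint Q ψ
  calc ⟪y, greenK T hpos (greenK T hpos y)⟫_𝕜 = ⟪T (greenK T hpos y), greenK T hpos (greenK T hpos y)⟫_𝕜 := by rw [apply_greenK]
    _ = ⟪greenK T hpos y, T (greenK T hpos (greenK T hpos y))⟫_𝕜 := hTs _ _
    _ = ((‖greenK T hpos y‖ : ℝ) : 𝕜) ^ 2 := by rw [apply_greenK, inner_self_eq_norm_sq_to_K]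

include hTs in
/-- **FROM `re⟪Q†ψ, GQ†ψ⟫ ≥ κ₁‖ψ‖²` TO `re⟪ψ, QG²Q†ψ⟫ = ‖GQ†ψ‖² ≥ (κ₁∕N)²‖ψ‖²** when `‖Qv‖ ≤ N‖v‖` (`N > 0`, `κ₁ ≥ 0`): Cauchy–Schwarz
`re⟪Q†ψ, GQ†ψ⟫ = re⟪ψ, Q(GQ†ψ)⟫ ≤ ‖ψ‖·N·‖GQ†ψ‖`. [folklore] [cite: Balaban1985BackgroundPropagators, (3.25) p.394, Thm 3.11 p.416] -/
theorem sq_mul_norm_sq_le_re_inner_qggq (Q : E →ₗ[𝕜] F) {N κ₁ : ℝ} (hN : 0 < N) (hκ₁ : 0 ≤ κ₁) (hQ : ∀ v, ‖Q v‖ ≤ N * ‖v‖) (ψ : F)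
    (hψ : κ₁ * ‖ψ‖ ^ 2 ≤ RCLike.re ⟪LinearMap.adjoint Q ψ, greenK T hpos (LinearMap.adjoint Q ψ)⟫_𝕜) :
    (κ₁ / N) ^ 2 * ‖ψ‖ ^ 2 ≤
      RCLike.re ⟪ψ, (Q ∘ₗ greenK T hpos ∘ₗ greenK T hpos ∘ₗ LinearMap.adjoint Q) ψ⟫_𝕜 := by
  simp only [LinearMap.comp_apply]
  rw [inner_qggq_eq_norm_sq hTs hpos Q ψ]
  have hre : RCLike.re ((((‖greenK T hpos (LinearMap.adjoint Q ψ)‖ : ℝ) : 𝕜)) ^ 2) = ‖greenK T hpos (LinearMap.adjoint Q ψ)‖ ^ 2 := by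
    rw [← RCLike.ofReal_pow, RCLike.ofReal_re]
  rw [hre]
  set w := greenK T hpos (LinearMap.adjoint Q ψ) with hw
  -- Cauchy–Schwarz: `κ₁‖ψ‖² ≤ re⟪Q†ψ, w⟫ = re⟪ψ, Qw⟫ ≤ ‖ψ‖·N·‖w‖`
  have hcs : κ₁ * ‖ψ‖ ^ 2 ≤ ‖ψ‖ * (N * ‖w‖) := by
    refine hψ.trans ?_
    rw [LinearMap.adjoint_inner_left]
    exact (re_inner_le_norm ψ (Q w)).trans (mul_le_mul_of_nonneg_left (hQ w) (norm_nonneg _))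
  by_cases h0 : ψ = 0
  · rw [h0, norm_zero]; simp
  have hψpos : 0 < ‖ψ‖ := norm_pos_iff.2 h0
  -- `κ₁‖ψ‖ ≤ N‖w‖`
  have h1 : κ₁ * ‖ψ‖ ≤ N * ‖w‖ := by
    have : κ₁ * ‖ψ‖ * ‖ψ‖ ≤ N * ‖w‖ * ‖ψ‖ := by nlinarith
    exact le_of_mul_le_mul_right this hψpos
  have h2 : κ₁ / N * ‖ψ‖ ≤ ‖w‖ := by
    rw [div_mul_eq_mul_div, div_le_iff₀ hN]; linarith
  have h3 : 0 ≤ κ₁ / N * ‖ψ‖ := by positivity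
  calc (κ₁ / N) ^ 2 * ‖ψ‖ ^ 2 = (κ₁ / N * ‖ψ‖) ^ 2 := by ring
    _ ≤ ‖w‖ ^ 2 := pow_le_pow_left₀ h3 h2 2

end Abstract

/-! ## §2 S3c at the flat background: the explicit lower bound for `Q̃′G′(1)²Q̃′†` and its diagonal reading -/

section Assembly

variable {d : ℕ} (L : ℕ) [NeZero L] (m : Fin d → ℕ) [∀ i, NeZero (fineP L m i)]
  {𝔸 : Type*} [Ring 𝔸] [Algebra ℂ 𝔸] {W : Type*} [NormedAddCommGroup W] [InnerProductSpace ℂ W] [FiniteDimensional ℂ W]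
  (φ : W ≃ₗ[ℂ] 𝔸) (c₀ : ℝ) [Fact (0 < c₀)] (η : ℝ) (c₁ : ℝ) [Fact (0 < c₁)] {a' : ℝ}

/-- **S3c AT THE FLAT BACKGROUND — AN EXPLICIT, VOLUME-FREE LOWER BOUND FOR THE THIRD OPERATOR OF [B9] THM 3.11:
`κ·‖ψ‖² ≤ re⟪ψ, Q̃′G′(1)²Q̃′†ψ⟫ = ‖G′(1)Q̃′†ψ‖²`** for every coarse `ψ`, with `G′(1) = (Δ′_{a′}(1))⁻¹` (`GpOfU` at the displayed positivity),
`Q̃′ = Q′(1)` read into `L²(T_m; c₁)`, and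
`κ = (β²∕(E + a′β²))²·(c₀L^d∕c₁)`, `β = ((L−1)(L−2)∕6)^d`, `E = |η⁻¹|²·(L·(L²∕4)^{d−1})²·d·(c₀L^d∕c₁)` — a function of `(d, L, η, c₀L^d∕c₁, a′)`
ONLY: no `m` (volume), no operator norm of `Δ′_{a′}` (no bare `η⁻²`: `E∕β²` is `(ηL)⁻²` times a number), no `2^{dL}`.  First-order variational principle
(§1) at the tent test vector (`B9Eq319BlockTentLift`); `3 ≤ L`, `0 < a′`. [cite: Balaban1985BackgroundPropagators, Thm 3.11 p.416, (3.25) p.394; Balaban1984PropagatorsII, (2.74)–(2.77) p.236] -/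
theorem qggq_coercive_flat (hL3 : 3 ≤ L) {a' : ℝ} (ha' : 0 < a')
    (hpos' : ∀ x : SiteL2K ℂ d (fineP L m) c₀ W, x ≠ 0 →
      0 < RCLike.re ⟪x, laplacePrimeA L m φ η (fun _ : Bond d (fineP L m) => (1 : 𝔸ˣ)) a' (c₁ := c₁) x⟫_ℂ)
    (ψ : SiteL2K ℂ d m c₁ W) :
    (((((L : ℝ) - 1) * ((L : ℝ) - 2) / 6) ^ d) ^ 2 /
          (‖((η : ℂ))⁻¹‖ ^ 2 * ((L : ℝ) * ((L : ℝ) ^ 2 / 4) ^ (d - 1)) ^ 2 * (d : ℝ) * (c₀ * (L : ℝ) ^ d / c₁) +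
            a' * ((((L : ℝ) - 1) * ((L : ℝ) - 2) / 6) ^ d) ^ 2)) ^ 2 * (c₀ * (L : ℝ) ^ d / c₁) * ‖ψ‖ ^ 2 ≤
      RCLike.re ⟪ψ, (((WL2.linearEquiv ℂ ℂ (fun _ : TSite d m => c₁)).symm.toLinearMap ∘ₗ
          QprimeW L m φ (fun _ : Bond d (fineP L m) => (1 : 𝔸ˣ)) (c₀ := c₀)) ∘ₗ
        GpOfU L m φ η (fun _ : Bond d (fineP L m) => (1 : 𝔸ˣ)) a' (c₁ := c₁) hpos' ∘ₗ
        GpOfU L m φ η (fun _ : Bond d (fineP L m) => (1 : 𝔸ˣ)) a' (c₁ := c₁) hpos' ∘ₗ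
        LinearMap.adjoint ((WL2.linearEquiv ℂ ℂ (fun _ : TSite d m => c₁)).symm.toLinearMap ∘ₗ
          QprimeW L m φ (fun _ : Bond d (fineP L m) => (1 : 𝔸ˣ)) (c₀ := c₀))) ψ⟫_ℂ := by
  have hc₀ : 0 < c₀ := Fact.out
  have hc₁ : 0 < c₁ := Fact.out
  have hL0 : (0 : ℝ) < L := by exact_mod_cast lt_of_lt_of_le (by norm_num) hL3
  have hL1 : (3 : ℝ) ≤ L := by exact_mod_cast hL3
  -- the letters
  set Q : SiteL2K ℂ d (fineP L m) c₀ W →ₗ[ℂ] SiteL2K ℂ d m c₁ W :=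
    (WL2.linearEquiv ℂ ℂ (fun _ : TSite d m => c₁)).symm.toLinearMap ∘ₗ QprimeW L m φ (fun _ : Bond d (fineP L m) => (1 : 𝔸ˣ)) (c₀ := c₀)
    with hQ
  set T := laplacePrimeA L m φ η (fun _ : Bond d (fineP L m) => (1 : 𝔸ˣ)) a' (c₀ := c₀) (c₁ := c₁) with hT
  have hTs : T.IsSymmetric := laplacePrimeA_isSymmetric L m φ c₀ η _ c₁ a' (hRS_one φ)
  set S : ℝ := ∑ k ∈ Finset.range L, (k : ℝ) * ((L : ℝ) - 1 - k) with hS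
  set β : ℝ := (((L : ℝ) - 1) * ((L : ℝ) - 2) / 6) ^ d with hβ
  set D : ℝ := (L : ℝ) * ((L : ℝ) ^ 2 / 4) ^ (d - 1) with hD
  set ρw : ℝ := c₀ * (L : ℝ) ^ d / c₁ with hρw
  set E : ℝ := ‖((η : ℂ))⁻¹‖ ^ 2 * D ^ 2 * (d : ℝ) * ρw with hE
  have hβS : ((L : ℝ) ^ d)⁻¹ * S ^ d = β := by
    rw [hS, sum_profile_eq, hβ, ← inv_pow, ← mul_pow]
    congr 1
    field_simp
  have hβ0 : 0 < β := by
    rw [hβ]; exact pow_pos (by nlinarith) d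
  have hD0 : 0 ≤ D := by rw [hD]; positivity
  have hρw0 : 0 < ρw := by rw [hρw]; positivity
  have hE0 : 0 ≤ E := by rw [hE]; positivity
  have hM : 0 < E + a' * β ^ 2 := by positivity
  -- the test vector `u = tent · (ψ ∘ blk)`
  set ψt := WL2.equiv ℂ (fun _ : TSite d m => c₁) W ψ with hψt
  set u : SiteL2K ℂ d (fineP L m) c₀ W := (WL2.equiv ℂ (fun _ : TSite d (fineP L m) => c₀) W).symm
    (fun x => (((∏ ν, ((offset L m x ν : ℕ) : ℝ) * ((L : ℝ) - 1 - (offset L m x ν : ℕ))) : ℝ) : ℂ) • ψt (blockCoord L m x)) with hu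
  -- `Q u = β • ψ`
  have hQu : Q u = ((β : ℝ) : ℂ) • ψ := by
    rw [← hβS]
    exact QprimeWL2_one_lift L m φ c₀ c₁ _ (fun y => sum_blockOf_tent L m y) ψ
  -- (1) `β‖ψ‖² ≤ re⟪u, Q†ψ⟫`
  have hux : β * ‖ψ‖ ^ 2 ≤ RCLike.re ⟪u, LinearMap.adjoint Q ψ⟫_ℂ := by
    rw [LinearMap.adjoint_inner_right, hQu, inner_smul_left, Complex.conj_ofReal, ← inner_self_eq_norm_sq (𝕜 := ℂ) ψ]
    simp only [RCLike.re_to_complex, Complex.re_ofReal_mul, le_refl]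
  -- (2) `re⟪u, Tu⟫ ≤ (E + a′β²)‖ψ‖²`
  have huu : RCLike.re ⟪u, T u⟫_ℂ ≤ (E + a' * β ^ 2) * ‖ψ‖ ^ 2 := by
    rw [hT, re_inner_laplacePrimeA_one L m φ c₀ η c₁ a' u]
    have h1 := norm_sq_covDerivL2K_lift_le L m φ c₀ η c₁
      (fun x => ∏ ν, ((offset L m x ν : ℕ) : ℝ) * ((L : ℝ) - 1 - (offset L m x ν : ℕ))) (D := D) ψ (norm_tent_step_le L m ψt)
    have h2 : ‖Q u‖ ^ 2 = β ^ 2 * ‖ψ‖ ^ 2 := by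
      rw [hQu, norm_smul, Complex.norm_real, Real.norm_eq_abs, abs_of_pos hβ0, mul_pow]
    have h1' : ‖covDerivL2K ℂ c₀ ((η : ℂ))⁻¹ (adTransportW φ (fun _ : Bond d (fineP L m) => (1 : 𝔸ˣ))) u‖ ^ 2 ≤ E * ‖ψ‖ ^ 2 := by
      rw [hE, hρw]; exact h1
    rw [← hQ, h2, add_mul]
    have h3 : a' * (β ^ 2 * ‖ψ‖ ^ 2) = a' * β ^ 2 * ‖ψ‖ ^ 2 := by ring
    rw [h3]
    exact add_le_add h1' le_rfl
  -- (3) the first-order variational principle: `κ₁‖ψ‖² ≤ re⟪Q†ψ, G′Q†ψ⟫`, `κ₁ = β²∕(E + a′β²)`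
  have hG : ∀ z, GpOfU L m φ η (fun _ : Bond d (fineP L m) => (1 : 𝔸ˣ)) a' (c₁ := c₁) hpos' z = greenK T hpos' z := fun z => rfl
  have hκ₁ := sq_div_mul_le_re_inner_green hTs hpos' hM hβ0.le hux huu
  -- (4) Cauchy–Schwarz with `‖Q̃′‖ ≤ N := √(c₁∕(c₀L^d))`
  have hN0 : 0 < Real.sqrt (c₁ / (c₀ * (L : ℝ) ^ d)) := Real.sqrt_pos.2 (by positivity)
  have hQn : ∀ v, ‖Q v‖ ≤ Real.sqrt (c₁ / (c₀ * (L : ℝ) ^ d)) * ‖v‖ := fun v => by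
    have h := norm_sq_QprimeWL2_one_le L m φ c₀ c₁ v
    rw [← hQ] at h
    refine (pow_le_pow_iff_left₀ (norm_nonneg _) (by positivity) two_ne_zero).1 ?_
    rw [mul_pow, Real.sq_sqrt (by positivity)]
    exact h
  have hfin := sq_mul_norm_sq_le_re_inner_qggq hTs hpos' Q hN0 (by positivity) hQn ψ hκ₁
  -- (5) the constant: `(κ₁∕N)² = κ₁²·(c₀L^d∕c₁)`
  have hconst : (β ^ 2 / (E + a' * β ^ 2) / Real.sqrt (c₁ / (c₀ * (L : ℝ) ^ d))) ^ 2 =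
      (β ^ 2 / (E + a' * β ^ 2)) ^ 2 * (c₀ * (L : ℝ) ^ d / c₁) := by
    rw [div_pow, Real.sq_sqrt (by positivity)]
    field_simp
  rw [hconst, hE, hρw] at hfin
  simpa only [LinearMap.comp_apply, hG] using hfin

/-- **THE SAME WITH THE POSITIVITY DISCHARGED** (`B9Thm311DeltaPrimeA.laplacePrimeA_one_pos`: `η ≠ 0`, `a′ > 0` only): the operator of
ne9-leaf-06's `B9Eq325ProjFormula.QGGQ_pos_one` VERBATIM is bounded below by the `κ` of `qggq_coercive_flat` — no displayed letter left at the flat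
background but `3 ≤ L`. [cite: Balaban1985BackgroundPropagators, Thm 3.11 p.416, (3.25) p.394; Balaban1984PropagatorsII, (2.74)–(2.77) p.236] -/
theorem qggq_coercive_one (hL3 : 3 ≤ L) (hη : η ≠ 0) {a' : ℝ} (ha' : 0 < a') (ψ : SiteL2K ℂ d m c₁ W) :
    (((((L : ℝ) - 1) * ((L : ℝ) - 2) / 6) ^ d) ^ 2 /
          (‖((η : ℂ))⁻¹‖ ^ 2 * ((L : ℝ) * ((L : ℝ) ^ 2 / 4) ^ (d - 1)) ^ 2 * (d : ℝ) * (c₀ * (L : ℝ) ^ d / c₁) +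
            a' * ((((L : ℝ) - 1) * ((L : ℝ) - 2) / 6) ^ d) ^ 2)) ^ 2 * (c₀ * (L : ℝ) ^ d / c₁) * ‖ψ‖ ^ 2 ≤
      RCLike.re ⟪ψ, (((WL2.linearEquiv ℂ ℂ (fun _ : TSite d m => c₁)).symm.toLinearMap ∘ₗ
          QprimeW L m φ (fun _ : Bond d (fineP L m) => (1 : 𝔸ˣ)) (c₀ := c₀)) ∘ₗ
        GpOfU L m φ η (fun _ : Bond d (fineP L m) => (1 : 𝔸ˣ)) a' (c₁ := c₁) (laplacePrimeA_one_pos L m φ η a' hη ha') ∘ₗ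
        GpOfU L m φ η (fun _ : Bond d (fineP L m) => (1 : 𝔸ˣ)) a' (c₁ := c₁) (laplacePrimeA_one_pos L m φ η a' hη ha') ∘ₗ
        LinearMap.adjoint ((WL2.linearEquiv ℂ ℂ (fun _ : TSite d m => c₁)).symm.toLinearMap ∘ₗ
          QprimeW L m φ (fun _ : Bond d (fineP L m) => (1 : 𝔸ˣ)) (c₀ := c₀))) ψ⟫_ℂ :=
  qggq_coercive_flat L m φ c₀ η c₁ hL3 ha' _ ψ

/-- **THE (d3)-η READING ON THE DIAGONAL**: at `ηL = 1` and canonical weights `c₀L^d = c₁`, the constant of `qggq_coercive_flat` is bounded BELOW by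
`1∕(16d·(729∕16)^d + a′)²` — a number depending on `d` and `a′` ONLY (using `(L−1)(L−2)∕6 ≥ L²∕27` for `L ≥ 3`). [cite: Balaban1985BackgroundPropagators, Thm 3.11 p.416, (3.35) p.396] -/
theorem qggq_constant_diagonal_ge {L : ℕ} (hL3 : 3 ≤ L) {η c₀ c₁ a' : ℝ} (hη : η * L = 1) (hw : c₀ * (L : ℝ) ^ d = c₁) (hc₁ : 0 < c₁)
    (ha' : 0 < a') :
    1 / (16 * (d : ℝ) * (729 / 16) ^ d + a') ^ 2 ≤
      (((((L : ℝ) - 1) * ((L : ℝ) - 2) / 6) ^ d) ^ 2 /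
          (‖((η : ℂ))⁻¹‖ ^ 2 * ((L : ℝ) * ((L : ℝ) ^ 2 / 4) ^ (d - 1)) ^ 2 * (d : ℝ) * (c₀ * (L : ℝ) ^ d / c₁) +
            a' * ((((L : ℝ) - 1) * ((L : ℝ) - 2) / 6) ^ d) ^ 2)) ^ 2 * (c₀ * (L : ℝ) ^ d / c₁) := by
  have hL0 : (0 : ℝ) < L := by exact_mod_cast lt_of_lt_of_le (by norm_num) hL3
  have hL1 : (3 : ℝ) ≤ L := by exact_mod_cast hL3
  have hρ : c₀ * (L : ℝ) ^ d / c₁ = 1 := by rw [hw, div_self hc₁.ne']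
  have hηinv : ‖((η : ℂ))⁻¹‖ = L := by
    have hη' : η = 1 / L := by field_simp; linarith
    rw [norm_inv, Complex.norm_real, Real.norm_eq_abs, hη', abs_of_pos (by positivity), one_div, inv_inv]
  rw [hρ, hηinv, mul_one, mul_one]
  set β : ℝ := (((L : ℝ) - 1) * ((L : ℝ) - 2) / 6) ^ d with hβ
  have hβ0 : 0 < β := by rw [hβ]; exact pow_pos (by nlinarith) d
  -- `β ≥ (L²∕27)^d` and `E ≤ 16d(729∕16)^d·β²`
  have hβge : ((L : ℝ) ^ 2 / 27) ^ d ≤ β := by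
    rw [hβ]; exact pow_le_pow_left₀ (by positivity) (by nlinarith) d
  have hE : (L : ℝ) ^ 2 * ((L : ℝ) * ((L : ℝ) ^ 2 / 4) ^ (d - 1)) ^ 2 * (d : ℝ) ≤ 16 * (d : ℝ) * (729 / 16) ^ d * β ^ 2 := by
    rcases Nat.eq_zero_or_pos d with hd | hd
    · subst hd; simp
    · obtain ⟨e, rfl⟩ : ∃ e, d = e + 1 := ⟨d - 1, (Nat.sub_add_cancel hd).symm⟩
      rw [Nat.add_sub_cancel]
      have h1 : ((L : ℝ) ^ 2 / 27) ^ (e + 1) ≤ β := hβge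
      have h2 : 0 ≤ ((L : ℝ) ^ 2 / 27) ^ (e + 1) := by positivity
      have h3 : (((L : ℝ) ^ 2 / 27) ^ (e + 1)) ^ 2 ≤ β ^ 2 := pow_le_pow_left₀ h2 h1 2
      -- `L² (L (L²/4)^e)² = 16·(729/16)^{e+1}·((L²/27)^{e+1})²` (an identity; induction on `e`)
      have e4 : ∀ n : ℕ, (L : ℝ) ^ 2 * ((L : ℝ) * ((L : ℝ) ^ 2 / 4) ^ n) ^ 2 = 16 * (729 / 16) ^ (n + 1) * (((L : ℝ) ^ 2 / 27) ^ (n + 1)) ^ 2 := by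
        intro n
        induction n with
        | zero => ring
        | succ n ih =>
          have hs : (L : ℝ) ^ 2 * ((L : ℝ) * ((L : ℝ) ^ 2 / 4) ^ (n + 1)) ^ 2 =
              ((L : ℝ) ^ 2 * ((L : ℝ) * ((L : ℝ) ^ 2 / 4) ^ n) ^ 2) * (((L : ℝ) ^ 2 / 4) ^ 2) := by ring
          rw [hs, ih, pow_succ ((729 : ℝ) / 16) (n + 1), pow_succ ((L : ℝ) ^ 2 / 27) (n + 1)]
          ring
      calc (L : ℝ) ^ 2 * ((L : ℝ) * ((L : ℝ) ^ 2 / 4) ^ e) ^ 2 * ((e + 1 : ℕ) : ℝ)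
          = ((e + 1 : ℕ) : ℝ) * (16 * (729 / 16) ^ (e + 1) * (((L : ℝ) ^ 2 / 27) ^ (e + 1)) ^ 2) := by rw [← e4 e]; ring
        _ ≤ ((e + 1 : ℕ) : ℝ) * (16 * (729 / 16) ^ (e + 1) * β ^ 2) := by gcongr
        _ = 16 * ((e + 1 : ℕ) : ℝ) * (729 / 16) ^ (e + 1) * β ^ 2 := by ring
  -- `κ₁ = β²/(E + a′β²) ≥ 1/(16d(729/16)^d + a′)`
  have hK : 0 < 16 * (d : ℝ) * (729 / 16) ^ d + a' := by positivity
  have hden : 0 < (L : ℝ) ^ 2 * ((L : ℝ) * ((L : ℝ) ^ 2 / 4) ^ (d - 1)) ^ 2 * (d : ℝ) + a' * β ^ 2 := by positivity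
  have hk1 : 1 / (16 * (d : ℝ) * (729 / 16) ^ d + a') ≤ β ^ 2 / ((L : ℝ) ^ 2 * ((L : ℝ) * ((L : ℝ) ^ 2 / 4) ^ (d - 1)) ^ 2 * (d : ℝ) + a' * β ^ 2) := by
    rw [div_le_div_iff₀ hK hden, one_mul]
    nlinarith [hE, hβ0]
  have hk0 : 0 ≤ 1 / (16 * (d : ℝ) * (729 / 16) ^ d + a') := by positivity
  have hfin := pow_le_pow_left₀ hk0 hk1 2
  rwa [one_div_pow] at hfin

end Assembly

end Literature.MathematicalPhysics.QuantumFieldTheory.Balaban1983to89.B9Eq365QGGQLowerVariational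

end
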